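import Literature.MathematicalPhysics.QuantumFieldTheory.Balaban1983to89.Node00.Record13LiveSelectorFamily
import Literature.MathematicalPhysics.QuantumFieldTheory.Balaban1983to89.Node00.Record12BgRowAnalysis

/-!
# NODE 00 (YM-PLAN Track A) — STAGE 13, REV 18: THE K0a FACES AND THE ⁗ SOCKET FOR node00-def-T's SEPARATED-RANGE PROVISOS `Stage13Params.Provisos₁₃Sep`
# (`Record13` v1.2, director-ym LINE №138 deprecate-and-add: row P11 `bg` = def-R's `BgProvisoΛ` over the SEPARATED support `suppOfRecord₁₃Sep` — [6] (1.3)–(1.6) — along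
# PARTITION-COMPATIBLE runs `PartCompat₁₃` — [III] p. 257, plan g67 WORD-T2); the bg-free CORE `Provisos₁₃Core` at every live witness OUTRIGHT

Cell `pub-ymgap`, seat `pub-ymgap-node00-def-K0a` (g5), FILE 12a (companions: 12b `Node00/Record13SepBgRowOfThm1C` — the guarded row per run at `θ₁₅ᶜ`; 12c
`Node00/Record13SepInhabitedOfThm1C` — the K0⁗ body).  [III] = [Balaban1988Convergent], [IV] = [Balaban1989LargeFieldI], [6] = [Balaban1985RegularSpaces].
The deprecated `Provisos₁₃` and its faces (FILE 8∕9) stay untouched; this file re-does FILE 8 §1's constructor and FILE 9 §3's socket for the v1.2 structures.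

WHAT THIS FILE PROVES (theorems only).
* §1 at a generic `θ : Stage13Params`: `Stage13Params.bgProvisoΛ_suppSep_iff` (the token over the separated support ⟺ the SEPARATION-GUARDED BODY, FILE 11b's
  conclusion shape `∀ s, SeqSeparated θ.ν.M₁ s → ∀ 𝐖 ∈ suppOfRecord₁₃ θ p n s, ∀ j X, (I) ∧ (MS)`), `suppOfRecord₁₃Sep_liveRepin₁₃` (`rfl`), `partCompat₁₃_liveRepin₁₃_iff`
  (`Iff.rfl`), `Stage13Params.provisos₁₃Sep_of_core (hc) (hbg)` (core + guarded token ⇒ `Provisos₁₃Sep`), ★ `Stage13Params.provisos₁₃Core_liveRepin₁₃_of_localBg (hU) (hres)`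
  ∕ ★★ `…_of_hasResiduals (hres)` — THE bg-FREE CORE HOLDS AT THE ₁₃ LIVE RE-PIN OF EVERY PARAMETER CARRYING K0b's RESIDUALS, OUTRIGHT (`Record13` §4c + K0b's laws;
  (H-U) := K0c's `localBgMeasurable`) — and `Stage13Params.provisos₁₃Sep_liveRepin₁₃_of_localBg (hU) (hres) (hbg)` ∕ `…_of_bgSep (hres) (hbgSep)` (`Provisos₁₃Sep` at the
  re-pin ⟸ the guarded row ALONE, token or body form; adapter `fun p n hn hw hpc s W hW => hbgSep p n hn hw hpc s hW.2 W hW.1`, def-T FILED-18 (i)).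
* §2 at the all-numerics family `θ₁₃(n, ε₂₉) = theta13LiveOfNumerics F N n ε₂₉ (ζ, Rz, Zt of record)`: ★ `provisos₁₃Core_theta13LiveOfNumerics_of_hasResiduals` (HYPOTHESIS-FREE),
  `provisos₁₃Sep_theta13LiveOfNumerics_of_bgSep (hbgSep)`, ★★★ THE ⁗ SOCKET `exists_k0Sep_of_bgSep_theta13LiveOfNumerics (F) (hn : n.Pos) (hε' : 0 < ε₂₉) (hbgSep) :
  ∃ θ : Stage13Params F 2, θ.Provisos₁₃Sep F 2 ∧ (θ.ZtUnity F 2 ∧ θ.SlotsNondegenerate₁₃ F 2) ∧ θ.Admissible F 2` (rows Z ∕ P12 ∕ G theorems at the member — P12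
  hypothesis-free by FILE 9 v1.1), and `exists_k0Sep_of_exists_k0` (the print-stronger K0‴ body gives the ⁗ one, def-T's `.toSep`; converse NOT claimed).

HONEST FRAMING.  Bookkeeping (structure constructors, an unfolding `iff`, instantiation by name); the guarded row `hbg`∕`hbgSep` is a DISPLAYED HYPOTHESIS (row P11 on
print's sequences and partition-compatible runs — seat node00-def-P11's analysis; FILE 12b∕12c supply it at `θ₁₅ᶜ` from the faithful named fact + (R2) + (hcomp)); nothing of
Bałaban asserted; NOT a discharge; counts unmoved (typed 28∕28 · discharged 5∕28); one finite 𝕋⁴ programme at fixed ε — NOT continuum ∕ OS ∕ mass gap ∕ Clay.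
No `sorry`, `axiom`, `def`, `instance`, `notation`.
-/

noncomputable section

open MeasureTheory
open scoped Matrix.Norms.L2Operator

namespace Literature.MathematicalPhysics.QuantumFieldTheory.Balaban1983to89.Node00

open T4Continuum B14.Eq218Concrete B15DeterminingSets B15RopTotal FlowStep FlowStepRuns

/-! ## §1. At a generic Stage-13 parameter: token ⟺ separation-guarded body; the bg-free core at the ₁₃ live re-pin OUTRIGHT; `Provisos₁₃Sep` there from the guarded row alone -/

section Repin13Sep

variable (F : T4Family) (N : ℕ) [NeZero N] (θ : Stage13Params F N)

/-- **THE TOKEN OVER THE SEPARATED SUPPORT UNFOLDS TO THE SEPARATION-GUARDED BODY, level by level**: def-R's ranged token `BgProvisoΛ` over def-T's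
`suppOfRecord₁₃Sep θ p n s = {𝐖 ∈ suppOfRecord₁₃ θ p n s | Sect2.SeqSeparated θ.ν.M₁ s}` ⟺ the two guarded memberships of the background of record demanded for PRINT'S
(separated, [6] (1.3)–(1.6)) sequences only — FILE 11b's conclusion shape (node00-def-P11 LOCATED-P11-SEQ). [cite: Balaban1985RegularSpaces, (1.3)–(1.6) p.77; Balaban1988Convergent, (2.27)–(2.28) p.259, (2.34)–(2.41) p.261 (bookkeeping)] -/
theorem Stage13Params.bgProvisoΛ_suppSep_iff (p : B12.RunParams) (n : ℕ) :
    BgProvisoΛ F N p.K (settingOfRecord₁₃ F N θ p) (θ.Rz p.K) θ.τ9.M n (suppOfRecord₁₃Sep F N θ p n) (UbgOfRecord₁₃ F N θ p n) ↔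
      ∀ s : SeqOfRecord F θ.ν θ.τ9.M (gOfRecord₁₃ F N θ p) p.K n, Sect2.SeqSeparated θ.ν.M₁ s →
      ∀ W : MSField (F.P p.K) (SU N), W ∈ suppOfRecord₁₃ F N θ p n s →
      ∀ j, 1 ≤ j → j ≤ n → ∀ X : (Sect2.domSys (F.P p.K) θ.τ9.M j).Dom,
      (Sect2.domSites (F.P p.K) θ.τ9.M j X ⊆ s.Λ j →
        Sect2.ofBackgroundC (settingOfRecord₁₃ F N θ p).ι (UbgOfRecord₁₃ F N θ p n s W) ∈
          Sect2.spaceI (settingOfRecord₁₃ F N θ p) (θ.Rz p.K) θ.τ9.M j (Sect2.domSites (F.P p.K) θ.τ9.M j X)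
            ((settingOfRecord₁₃ F N θ p).lf.alpha0 ((settingOfRecord₁₃ F N θ p).flow.g j)) ((settingOfRecord₁₃ F N θ p).lf.alpha1 ((settingOfRecord₁₃ F N θ p).flow.g j))) ∧
      (Sect2.admB (F.P p.K) θ.ν θ.τ9.M (gOfRecord₁₃ F N θ p) s.Ω s.Λ j (Sect2.domSites (F.P p.K) θ.τ9.M j X) = true →
        Sect2.ofBackgroundC (settingOfRecord₁₃ F N θ p).ι (UbgOfRecord₁₃ F N θ p n s W) ∈
          Sect2.spaceMS (settingOfRecord₁₃ F N θ p) (θ.Rz p.K) θ.τ9.M j (Sect2.domSites (F.P p.K) θ.τ9.M j X) s.Ω) :=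
  ⟨fun h s hs W hW => h s W ⟨hW, hs⟩, fun h s W hW => h s hW.2 W hW.1⟩

/-- The separated support is selector-blind: at the ₁₃ re-pin it IS `θ`'s (`rfl`). [cite: Balaban1988Convergent, (2.10) p.256 (bookkeeping)] -/
theorem Stage13Params.suppOfRecord₁₃Sep_liveRepin₁₃ (p : B12.RunParams) (n : ℕ) :
    suppOfRecord₁₃Sep F N (θ.liveRepin₁₃ F N) p n = suppOfRecord₁₃Sep F N θ p n := rfl

/-- The partition-compatibility of a run is selector-blind (`Iff.rfl`). [cite: Balaban1988Convergent, p.257 (bookkeeping)] -/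
theorem Stage13Params.partCompat₁₃_liveRepin₁₃_iff (p : B12.RunParams) (n : ℕ) :
    PartCompat₁₃ F N (θ.liveRepin₁₃ F N) p n ↔ PartCompat₁₃ F N θ p n := Iff.rfl

variable {F N θ}

/-- **`Provisos₁₃Sep` = THE bg-FREE CORE + THE GUARDED ROW** (named-field constructor; the token is the field's type verbatim). [cite: Balaban1988Convergent, (2.18) p.257, (2.28) p.259 (bookkeeping)] -/
theorem Stage13Params.provisos₁₃Sep_of_core (hc : θ.Provisos₁₃Core F N)
    (hbg : ∀ (p : B12.RunParams) (n : ℕ), n ≤ p.K → Step.InInterval θ.γ n (gOfRecord₁₃ F N θ p) → PartCompat₁₃ F N θ p n →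
      BgProvisoΛ F N p.K (settingOfRecord₁₃ F N θ p) (θ.Rz p.K) θ.τ9.M n (suppOfRecord₁₃Sep F N θ p n) (UbgOfRecord₁₃ F N θ p n)) :
    θ.Provisos₁₃Sep F N where
  intPiece := hc.intPiece
  measω := hc.measω
  measChi := hc.measChi
  zetaUnity := hc.zetaUnity
  zetaAbs := hc.zetaAbs
  rstep := hc.rstep
  rzLaws := hc.rzLaws
  ztLaws := hc.ztLaws
  ztLocal := hc.ztLocal
  bg := hbg

/-- **★ THE bg-FREE CORE AT THE ₁₃ LIVE RE-PIN OF A PARAMETER CARRYING K0b's RESIDUALS, FROM (H-U) ALONE** (FILE 8's `provisos₁₃_liveRepin₁₃_of_localBg` minus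
row P11): rows `intPiece` ∕ `measω` ∕ `measChi` ∕ `rstep` (Int form, at the live selector — `hsel` is `rfl`) are `Record13` §4c's theorems of (H-U) `LocalBgMeasurable θ.ν`
and the ζ-laws of K0b's (3.16) factor; `zetaUnity`, `zetaAbs`, `rzLaws`, `ztLaws`, `ztLocal` are K0b's.  A REDUCTION — nothing of Bałaban asserted.
[cite: Balaban1988Convergent, (2.18) p.257, (2.21) p.258, (3.2)–(3.9) pp.265–266, (3.16) p.268, (3.20)–(3.22) p.269, (3.24)–(3.25) p.270; Balaban1989LargeFieldI, (0.3)–(0.4) p.176 and p.177 (bookkeeping)] -/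
theorem Stage13Params.provisos₁₃Core_liveRepin₁₃_of_localBg (hU : LocalBgMeasurable F N θ.ν) (hres : θ.HasResidualsOfRecord F N) :
    (θ.liveRepin₁₃ F N).Provisos₁₃Core F N :=
  have hζ : ZetaMeasurable F N θ.ζ := by
    rw [hres.zeta_eq]; exact zetaMeasurable_zeta316OfRecord_of_localBg hU θ.τ9.M θ.A₁
  have hζ0 : ∀ p g k s Pl Ql RS U V', 0 ≤ θ.ζ p g k s Pl Ql RS U V' := by
    rw [hres.zeta_eq]; exact fun p g k s Pl Ql RS U V' => zeta316OfRecord_nonneg θ.A₁ p g k s Pl Ql RS U V'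
  { intPiece := (θ.liveRepin₁₃ F N).intPiece₁₃_of_localBg hU hζ hres.zetaAbs hζ0
    measω := (θ.liveRepin₁₃ F N).measω₁₃_of_localBg hU hζ
    measChi := (θ.liveRepin₁₃ F N).measChi₁₃_of_localBg hU
    zetaUnity := hres.zetaUnity
    zetaAbs := hres.zetaAbs
    rstep := (θ.liveRepin₁₃ F N).rstep₁₃_of_localBg_liveSel rfl hU hζ hres.zetaAbs hζ0
    rzLaws := hres.rzLaws
    ztLaws := hres.ztLaws
    ztLocal := hres.ztLocal }

/-- **★★ THE bg-FREE CORE AT THE ₁₃ LIVE RE-PIN OF A PARAMETER CARRYING K0b's RESIDUALS — OUTRIGHT** ((H-U) is seat K0c's THEOREM `localBgMeasurable`,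
`Node00/Record12MeasurabilityAbsolute`): EVERY ROW OF THE RECORD'S PROVISOS EXCEPT P11 holds at every such witness; the datum keyed on the core
(`datumOfRecord₁₃Core`) is therefore hypothesis-free there. [cite: Balaban1988Convergent, (2.12) p.256, (2.18) p.257, (3.16) p.268, (3.22) p.269; Balaban1989LargeFieldI, (0.3)–(0.4) p.176 (bookkeeping)] -/
theorem Stage13Params.provisos₁₃Core_liveRepin₁₃_of_hasResiduals (hres : θ.HasResidualsOfRecord F N) : (θ.liveRepin₁₃ F N).Provisos₁₃Core F N :=
  θ.provisos₁₃Core_liveRepin₁₃_of_localBg (localBgMeasurable F N θ.ν) hres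

/-- **★ `Provisos₁₃Sep` AT THE ₁₃ LIVE RE-PIN from (H-U), K0b's residuals and THE GUARDED ROW ALONE** (token form — verbatim the field's type at the re-pin; row P11 on
print's sequences and partition-compatible runs is DISPLAYED, seat node00-def-P11's analysis). [cite: Balaban1988Convergent, (2.18) p.257, (2.28) p.259, (3.16) p.268, (3.22) p.269; Balaban1985RegularSpaces, (1.3)–(1.6) p.77; Balaban1989LargeFieldI, (0.3)–(0.4) p.176 (bookkeeping)] -/
theorem Stage13Params.provisos₁₃Sep_liveRepin₁₃_of_localBg (hU : LocalBgMeasurable F N θ.ν) (hres : θ.HasResidualsOfRecord F N)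
    (hbg : ∀ (p : B12.RunParams) (n : ℕ), n ≤ p.K → Step.InInterval (θ.liveRepin₁₃ F N).γ n (gOfRecord₁₃ F N (θ.liveRepin₁₃ F N) p) → PartCompat₁₃ F N (θ.liveRepin₁₃ F N) p n →
      BgProvisoΛ F N p.K (settingOfRecord₁₃ F N (θ.liveRepin₁₃ F N) p) ((θ.liveRepin₁₃ F N).Rz p.K) (θ.liveRepin₁₃ F N).τ9.M n (suppOfRecord₁₃Sep F N (θ.liveRepin₁₃ F N) p n) (UbgOfRecord₁₃ F N (θ.liveRepin₁₃ F N) p n)) :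
    (θ.liveRepin₁₃ F N).Provisos₁₃Sep F N :=
  (θ.liveRepin₁₃ F N).provisos₁₃Sep_of_core (θ.provisos₁₃Core_liveRepin₁₃_of_localBg hU hres) hbg

/-- **★ `Provisos₁₃Sep` AT THE ₁₃ LIVE RE-PIN from (H-U), K0b's residuals and THE SEPARATION-GUARDED BODY** (FILE 11b∕12b's conclusion shape at the re-pin; adapter
`fun p n hn hw hpc s W hW => hbgSep p n hn hw hpc s hW.2 W hW.1`, def-T FILED-18 (i)). [cite: Balaban1988Convergent, (2.28) p.259, (3.16) p.268, (3.22) p.269; Balaban1985RegularSpaces, (1.3)–(1.6) p.77; Balaban1989LargeFieldI, (0.3)–(0.4) p.176 (bookkeeping)] -/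
theorem Stage13Params.provisos₁₃Sep_liveRepin₁₃_of_localBg_of_bgSep (hU : LocalBgMeasurable F N θ.ν) (hres : θ.HasResidualsOfRecord F N)
    (hbgSep : ∀ (p : B12.RunParams) (n : ℕ), n ≤ p.K → Step.InInterval (θ.liveRepin₁₃ F N).γ n (gOfRecord₁₃ F N (θ.liveRepin₁₃ F N) p) → PartCompat₁₃ F N (θ.liveRepin₁₃ F N) p n →
      ∀ s : SeqOfRecord F (θ.liveRepin₁₃ F N).ν (θ.liveRepin₁₃ F N).τ9.M (gOfRecord₁₃ F N (θ.liveRepin₁₃ F N) p) p.K n, Sect2.SeqSeparated (θ.liveRepin₁₃ F N).ν.M₁ s →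
      ∀ W : MSField (F.P p.K) (SU N), W ∈ suppOfRecord₁₃ F N (θ.liveRepin₁₃ F N) p n s →
      ∀ j, 1 ≤ j → j ≤ n → ∀ X : (Sect2.domSys (F.P p.K) (θ.liveRepin₁₃ F N).τ9.M j).Dom,
      (Sect2.domSites (F.P p.K) (θ.liveRepin₁₃ F N).τ9.M j X ⊆ s.Λ j →
        Sect2.ofBackgroundC (settingOfRecord₁₃ F N (θ.liveRepin₁₃ F N) p).ι (UbgOfRecord₁₃ F N (θ.liveRepin₁₃ F N) p n s W) ∈
          Sect2.spaceI (settingOfRecord₁₃ F N (θ.liveRepin₁₃ F N) p) ((θ.liveRepin₁₃ F N).Rz p.K) (θ.liveRepin₁₃ F N).τ9.M j (Sect2.domSites (F.P p.K) (θ.liveRepin₁₃ F N).τ9.M j X)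
            ((settingOfRecord₁₃ F N (θ.liveRepin₁₃ F N) p).lf.alpha0 ((settingOfRecord₁₃ F N (θ.liveRepin₁₃ F N) p).flow.g j)) ((settingOfRecord₁₃ F N (θ.liveRepin₁₃ F N) p).lf.alpha1 ((settingOfRecord₁₃ F N (θ.liveRepin₁₃ F N) p).flow.g j))) ∧
      (Sect2.admB (F.P p.K) (θ.liveRepin₁₃ F N).ν (θ.liveRepin₁₃ F N).τ9.M (gOfRecord₁₃ F N (θ.liveRepin₁₃ F N) p) s.Ω s.Λ j (Sect2.domSites (F.P p.K) (θ.liveRepin₁₃ F N).τ9.M j X) = true →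
        Sect2.ofBackgroundC (settingOfRecord₁₃ F N (θ.liveRepin₁₃ F N) p).ι (UbgOfRecord₁₃ F N (θ.liveRepin₁₃ F N) p n s W) ∈
          Sect2.spaceMS (settingOfRecord₁₃ F N (θ.liveRepin₁₃ F N) p) ((θ.liveRepin₁₃ F N).Rz p.K) (θ.liveRepin₁₃ F N).τ9.M j (Sect2.domSites (F.P p.K) (θ.liveRepin₁₃ F N).τ9.M j X) s.Ω)) :
    (θ.liveRepin₁₃ F N).Provisos₁₃Sep F N :=
  θ.provisos₁₃Sep_liveRepin₁₃_of_localBg hU hres fun p n hn hw hpc s W hW => hbgSep p n hn hw hpc s hW.2 W hW.1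

/-- **★★ `Provisos₁₃Sep` AT THE ₁₃ LIVE RE-PIN OF A PARAMETER CARRYING K0b's RESIDUALS FROM THE SEPARATION-GUARDED ROW ALONE** — (H-U) is seat K0c's THEOREM
`localBgMeasurable`; every other row by `provisos₁₃Core_liveRepin₁₃_of_hasResiduals`. [cite: Balaban1988Convergent, (2.12) p.256, (2.28) p.259, (3.16) p.268, (3.22) p.269; Balaban1985RegularSpaces, (1.3)–(1.6) p.77; Balaban1989LargeFieldI, (0.3)–(0.4) p.176 (bookkeeping)] -/
theorem Stage13Params.provisos₁₃Sep_liveRepin₁₃_of_bgSep (hres : θ.HasResidualsOfRecord F N)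
    (hbgSep : ∀ (p : B12.RunParams) (n : ℕ), n ≤ p.K → Step.InInterval (θ.liveRepin₁₃ F N).γ n (gOfRecord₁₃ F N (θ.liveRepin₁₃ F N) p) → PartCompat₁₃ F N (θ.liveRepin₁₃ F N) p n →
      ∀ s : SeqOfRecord F (θ.liveRepin₁₃ F N).ν (θ.liveRepin₁₃ F N).τ9.M (gOfRecord₁₃ F N (θ.liveRepin₁₃ F N) p) p.K n, Sect2.SeqSeparated (θ.liveRepin₁₃ F N).ν.M₁ s →
      ∀ W : MSField (F.P p.K) (SU N), W ∈ suppOfRecord₁₃ F N (θ.liveRepin₁₃ F N) p n s →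
      ∀ j, 1 ≤ j → j ≤ n → ∀ X : (Sect2.domSys (F.P p.K) (θ.liveRepin₁₃ F N).τ9.M j).Dom,
      (Sect2.domSites (F.P p.K) (θ.liveRepin₁₃ F N).τ9.M j X ⊆ s.Λ j →
        Sect2.ofBackgroundC (settingOfRecord₁₃ F N (θ.liveRepin₁₃ F N) p).ι (UbgOfRecord₁₃ F N (θ.liveRepin₁₃ F N) p n s W) ∈
          Sect2.spaceI (settingOfRecord₁₃ F N (θ.liveRepin₁₃ F N) p) ((θ.liveRepin₁₃ F N).Rz p.K) (θ.liveRepin₁₃ F N).τ9.M j (Sect2.domSites (F.P p.K) (θ.liveRepin₁₃ F N).τ9.M j X)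
            ((settingOfRecord₁₃ F N (θ.liveRepin₁₃ F N) p).lf.alpha0 ((settingOfRecord₁₃ F N (θ.liveRepin₁₃ F N) p).flow.g j)) ((settingOfRecord₁₃ F N (θ.liveRepin₁₃ F N) p).lf.alpha1 ((settingOfRecord₁₃ F N (θ.liveRepin₁₃ F N) p).flow.g j))) ∧
      (Sect2.admB (F.P p.K) (θ.liveRepin₁₃ F N).ν (θ.liveRepin₁₃ F N).τ9.M (gOfRecord₁₃ F N (θ.liveRepin₁₃ F N) p) s.Ω s.Λ j (Sect2.domSites (F.P p.K) (θ.liveRepin₁₃ F N).τ9.M j X) = true →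
        Sect2.ofBackgroundC (settingOfRecord₁₃ F N (θ.liveRepin₁₃ F N) p).ι (UbgOfRecord₁₃ F N (θ.liveRepin₁₃ F N) p n s W) ∈
          Sect2.spaceMS (settingOfRecord₁₃ F N (θ.liveRepin₁₃ F N) p) ((θ.liveRepin₁₃ F N).Rz p.K) (θ.liveRepin₁₃ F N).τ9.M j (Sect2.domSites (F.P p.K) (θ.liveRepin₁₃ F N).τ9.M j X) s.Ω)) :
    (θ.liveRepin₁₃ F N).Provisos₁₃Sep F N :=
  θ.provisos₁₃Sep_liveRepin₁₃_of_localBg_of_bgSep (localBgMeasurable F N θ.ν) hres hbgSep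

end Repin13Sep

/-! ## §2. At the all-numerics family `θ₁₃(n, ε₂₉)`: the core OUTRIGHT, `Provisos₁₃Sep` from the guarded row alone, and ★★★ THE ⁗ SOCKET -/

section AllNumericsSep

variable (F : T4Family) (N : ℕ) [NeZero N] (n : Stage12Numerics) (ε₂₉ : ℝ)

/-- **★ THE bg-FREE CORE AT EVERY MEMBER OF THE ALL-NUMERICS FAMILY AT K0b's RESIDUALS — HYPOTHESIS-FREE** (no `n.Pos`, no proviso).
[cite: Balaban1988Convergent, (2.18) p.257, (3.16) p.268, (3.22) p.269; Balaban1989LargeFieldI, (0.3)–(0.4) p.176 (bookkeeping)] -/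
theorem provisos₁₃Core_theta13LiveOfNumerics_of_hasResiduals : (theta13LiveOfNumerics F N n ε₂₉ (zeta316OfRecord F N n.ν n.τ9.M n.A₁) (RzOfRecord F N) (ZtOfRecord F N)).Provisos₁₃Core F N :=
  Stage13Params.provisos₁₃Core_liveRepin₁₃_of_hasResiduals (θ := theta13OfNumerics F N n ε₂₉ _ _ _) (hasResidualsOfRecord_theta13OfNumerics F N n ε₂₉)

/-- **★ `Provisos₁₃Sep` AT EVERY MEMBER OF THE ALL-NUMERICS FAMILY CARRYING K0b's RESIDUALS, FROM THE SEPARATION-GUARDED ROW THERE ALONE.**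
[cite: Balaban1988Convergent, (2.18) p.257, (2.28) p.259, (3.16) p.268, (3.22) p.269; Balaban1985RegularSpaces, (1.3)–(1.6) p.77; Balaban1989LargeFieldI, (0.3)–(0.4) p.176 (bookkeeping)] -/
theorem provisos₁₃Sep_theta13LiveOfNumerics_of_bgSep
    (hbgSep : ∀ (p : B12.RunParams) (m : ℕ), m ≤ p.K → Step.InInterval (theta13LiveOfNumerics F N n ε₂₉ (zeta316OfRecord F N n.ν n.τ9.M n.A₁) (RzOfRecord F N) (ZtOfRecord F N)).γ m (gOfRecord₁₃ F N (theta13LiveOfNumerics F N n ε₂₉ (zeta316OfRecord F N n.ν n.τ9.M n.A₁) (RzOfRecord F N) (ZtOfRecord F N)) p) → PartCompat₁₃ F N (theta13LiveOfNumerics F N n ε₂₉ (zeta316OfRecord F N n.ν n.τ9.M n.A₁) (RzOfRecord F N) (ZtOfRecord F N)) p m →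
      ∀ s : SeqOfRecord F (theta13LiveOfNumerics F N n ε₂₉ (zeta316OfRecord F N n.ν n.τ9.M n.A₁) (RzOfRecord F N) (ZtOfRecord F N)).ν (theta13LiveOfNumerics F N n ε₂₉ (zeta316OfRecord F N n.ν n.τ9.M n.A₁) (RzOfRecord F N) (ZtOfRecord F N)).τ9.M (gOfRecord₁₃ F N (theta13LiveOfNumerics F N n ε₂₉ (zeta316OfRecord F N n.ν n.τ9.M n.A₁) (RzOfRecord F N) (ZtOfRecord F N)) p) p.K m, Sect2.SeqSeparated (theta13LiveOfNumerics F N n ε₂₉ (zeta316OfRecord F N n.ν n.τ9.M n.A₁) (RzOfRecord F N) (ZtOfRecord F N)).ν.M₁ s →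
      ∀ W : MSField (F.P p.K) (SU N), W ∈ suppOfRecord₁₃ F N (theta13LiveOfNumerics F N n ε₂₉ (zeta316OfRecord F N n.ν n.τ9.M n.A₁) (RzOfRecord F N) (ZtOfRecord F N)) p m s →
      ∀ j, 1 ≤ j → j ≤ m → ∀ X : (Sect2.domSys (F.P p.K) (theta13LiveOfNumerics F N n ε₂₉ (zeta316OfRecord F N n.ν n.τ9.M n.A₁) (RzOfRecord F N) (ZtOfRecord F N)).τ9.M j).Dom,
      (Sect2.domSites (F.P p.K) (theta13LiveOfNumerics F N n ε₂₉ (zeta316OfRecord F N n.ν n.τ9.M n.A₁) (RzOfRecord F N) (ZtOfRecord F N)).τ9.M j X ⊆ s.Λ j →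
        Sect2.ofBackgroundC (settingOfRecord₁₃ F N (theta13LiveOfNumerics F N n ε₂₉ (zeta316OfRecord F N n.ν n.τ9.M n.A₁) (RzOfRecord F N) (ZtOfRecord F N)) p).ι (UbgOfRecord₁₃ F N (theta13LiveOfNumerics F N n ε₂₉ (zeta316OfRecord F N n.ν n.τ9.M n.A₁) (RzOfRecord F N) (ZtOfRecord F N)) p m s W) ∈
          Sect2.spaceI (settingOfRecord₁₃ F N (theta13LiveOfNumerics F N n ε₂₉ (zeta316OfRecord F N n.ν n.τ9.M n.A₁) (RzOfRecord F N) (ZtOfRecord F N)) p) ((theta13LiveOfNumerics F N n ε₂₉ (zeta316OfRecord F N n.ν n.τ9.M n.A₁) (RzOfRecord F N) (ZtOfRecord F N)).Rz p.K) (theta13LiveOfNumerics F N n ε₂₉ (zeta316OfRecord F N n.ν n.τ9.M n.A₁) (RzOfRecord F N) (ZtOfRecord F N)).τ9.M j (Sect2.domSites (F.P p.K) (theta13LiveOfNumerics F N n ε₂₉ (zeta316OfRecord F N n.ν n.τ9.M n.A₁) (RzOfRecord F N) (ZtOfRecord F N)).τ9.M j X)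
            ((settingOfRecord₁₃ F N (theta13LiveOfNumerics F N n ε₂₉ (zeta316OfRecord F N n.ν n.τ9.M n.A₁) (RzOfRecord F N) (ZtOfRecord F N)) p).lf.alpha0 ((settingOfRecord₁₃ F N (theta13LiveOfNumerics F N n ε₂₉ (zeta316OfRecord F N n.ν n.τ9.M n.A₁) (RzOfRecord F N) (ZtOfRecord F N)) p).flow.g j)) ((settingOfRecord₁₃ F N (theta13LiveOfNumerics F N n ε₂₉ (zeta316OfRecord F N n.ν n.τ9.M n.A₁) (RzOfRecord F N) (ZtOfRecord F N)) p).lf.alpha1 ((settingOfRecord₁₃ F N (theta13LiveOfNumerics F N n ε₂₉ (zeta316OfRecord F N n.ν n.τ9.M n.A₁) (RzOfRecord F N) (ZtOfRecord F N)) p).flow.g j))) ∧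
      (Sect2.admB (F.P p.K) (theta13LiveOfNumerics F N n ε₂₉ (zeta316OfRecord F N n.ν n.τ9.M n.A₁) (RzOfRecord F N) (ZtOfRecord F N)).ν (theta13LiveOfNumerics F N n ε₂₉ (zeta316OfRecord F N n.ν n.τ9.M n.A₁) (RzOfRecord F N) (ZtOfRecord F N)).τ9.M (gOfRecord₁₃ F N (theta13LiveOfNumerics F N n ε₂₉ (zeta316OfRecord F N n.ν n.τ9.M n.A₁) (RzOfRecord F N) (ZtOfRecord F N)) p) s.Ω s.Λ j (Sect2.domSites (F.P p.K) (theta13LiveOfNumerics F N n ε₂₉ (zeta316OfRecord F N n.ν n.τ9.M n.A₁) (RzOfRecord F N) (ZtOfRecord F N)).τ9.M j X) = true →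
        Sect2.ofBackgroundC (settingOfRecord₁₃ F N (theta13LiveOfNumerics F N n ε₂₉ (zeta316OfRecord F N n.ν n.τ9.M n.A₁) (RzOfRecord F N) (ZtOfRecord F N)) p).ι (UbgOfRecord₁₃ F N (theta13LiveOfNumerics F N n ε₂₉ (zeta316OfRecord F N n.ν n.τ9.M n.A₁) (RzOfRecord F N) (ZtOfRecord F N)) p m s W) ∈
          Sect2.spaceMS (settingOfRecord₁₃ F N (theta13LiveOfNumerics F N n ε₂₉ (zeta316OfRecord F N n.ν n.τ9.M n.A₁) (RzOfRecord F N) (ZtOfRecord F N)) p) ((theta13LiveOfNumerics F N n ε₂₉ (zeta316OfRecord F N n.ν n.τ9.M n.A₁) (RzOfRecord F N) (ZtOfRecord F N)).Rz p.K) (theta13LiveOfNumerics F N n ε₂₉ (zeta316OfRecord F N n.ν n.τ9.M n.A₁) (RzOfRecord F N) (ZtOfRecord F N)).τ9.M j (Sect2.domSites (F.P p.K) (theta13LiveOfNumerics F N n ε₂₉ (zeta316OfRecord F N n.ν n.τ9.M n.A₁) (RzOfRecord F N) (ZtOfRecord F N)).τ9.M j X) s.Ω)) :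
    (theta13LiveOfNumerics F N n ε₂₉ (zeta316OfRecord F N n.ν n.τ9.M n.A₁) (RzOfRecord F N) (ZtOfRecord F N)).Provisos₁₃Sep F N :=
  (theta13OfNumerics F N n ε₂₉ _ _ _).provisos₁₃Sep_liveRepin₁₃_of_bgSep (hasResidualsOfRecord_theta13OfNumerics F N n ε₂₉) hbgSep

/-- **★★★ THE ⁗ SOCKET — THE REV-18 K0 BODY FOR `F` AT `N = 2` AT ANY NUMERICS from `n.Pos`, `0 < ε₂₉` and THE SEPARATION-GUARDED ROW P11 there ALONE** (row Z by
K0b's residual laws, row P12 HYPOTHESIS-FREE by FILE 9's `slotsNondegenerate₁₃_theta13LiveOfNumerics_of_hasResiduals`, row G by `admissible_theta13LiveOfNumerics`): the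
socket a numerics-carrying supplier of the guarded row («∀ B₃ a₀ a₁, faithful [15]-fact → guarded row at θ₁₃(n(B₃, a₀, a₁))», FILE 12b∕12c) plugs into with no further K0a
definition.  A REDUCTION — NOT a discharge. [cite: Balaban1988Convergent, Thm 1 p.262, (2.7) p.255, (2.28) p.259, (3.16)–(3.22) pp.268–269; Balaban1985RegularSpaces, (1.3)–(1.6) p.77; Balaban1989LargeFieldI, (0.3)–(0.4) p.176 (bookkeeping)] -/
theorem exists_k0Sep_of_bgSep_theta13LiveOfNumerics (F : T4Family) {n : Stage12Numerics} {ε₂₉ : ℝ} (hn : n.Pos) (hε' : 0 < ε₂₉)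
    (hbgSep : ∀ (p : B12.RunParams) (m : ℕ), m ≤ p.K → Step.InInterval (theta13LiveOfNumerics F 2 n ε₂₉ (zeta316OfRecord F 2 n.ν n.τ9.M n.A₁) (RzOfRecord F 2) (ZtOfRecord F 2)).γ m (gOfRecord₁₃ F 2 (theta13LiveOfNumerics F 2 n ε₂₉ (zeta316OfRecord F 2 n.ν n.τ9.M n.A₁) (RzOfRecord F 2) (ZtOfRecord F 2)) p) → PartCompat₁₃ F 2 (theta13LiveOfNumerics F 2 n ε₂₉ (zeta316OfRecord F 2 n.ν n.τ9.M n.A₁) (RzOfRecord F 2) (ZtOfRecord F 2)) p m →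
      ∀ s : SeqOfRecord F (theta13LiveOfNumerics F 2 n ε₂₉ (zeta316OfRecord F 2 n.ν n.τ9.M n.A₁) (RzOfRecord F 2) (ZtOfRecord F 2)).ν (theta13LiveOfNumerics F 2 n ε₂₉ (zeta316OfRecord F 2 n.ν n.τ9.M n.A₁) (RzOfRecord F 2) (ZtOfRecord F 2)).τ9.M (gOfRecord₁₃ F 2 (theta13LiveOfNumerics F 2 n ε₂₉ (zeta316OfRecord F 2 n.ν n.τ9.M n.A₁) (RzOfRecord F 2) (ZtOfRecord F 2)) p) p.K m, Sect2.SeqSeparated (theta13LiveOfNumerics F 2 n ε₂₉ (zeta316OfRecord F 2 n.ν n.τ9.M n.A₁) (RzOfRecord F 2) (ZtOfRecord F 2)).ν.M₁ s →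
      ∀ W : MSField (F.P p.K) (SU 2), W ∈ suppOfRecord₁₃ F 2 (theta13LiveOfNumerics F 2 n ε₂₉ (zeta316OfRecord F 2 n.ν n.τ9.M n.A₁) (RzOfRecord F 2) (ZtOfRecord F 2)) p m s →
      ∀ j, 1 ≤ j → j ≤ m → ∀ X : (Sect2.domSys (F.P p.K) (theta13LiveOfNumerics F 2 n ε₂₉ (zeta316OfRecord F 2 n.ν n.τ9.M n.A₁) (RzOfRecord F 2) (ZtOfRecord F 2)).τ9.M j).Dom,
      (Sect2.domSites (F.P p.K) (theta13LiveOfNumerics F 2 n ε₂₉ (zeta316OfRecord F 2 n.ν n.τ9.M n.A₁) (RzOfRecord F 2) (ZtOfRecord F 2)).τ9.M j X ⊆ s.Λ j →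
        Sect2.ofBackgroundC (settingOfRecord₁₃ F 2 (theta13LiveOfNumerics F 2 n ε₂₉ (zeta316OfRecord F 2 n.ν n.τ9.M n.A₁) (RzOfRecord F 2) (ZtOfRecord F 2)) p).ι (UbgOfRecord₁₃ F 2 (theta13LiveOfNumerics F 2 n ε₂₉ (zeta316OfRecord F 2 n.ν n.τ9.M n.A₁) (RzOfRecord F 2) (ZtOfRecord F 2)) p m s W) ∈
          Sect2.spaceI (settingOfRecord₁₃ F 2 (theta13LiveOfNumerics F 2 n ε₂₉ (zeta316OfRecord F 2 n.ν n.τ9.M n.A₁) (RzOfRecord F 2) (ZtOfRecord F 2)) p) ((theta13LiveOfNumerics F 2 n ε₂₉ (zeta316OfRecord F 2 n.ν n.τ9.M n.A₁) (RzOfRecord F 2) (ZtOfRecord F 2)).Rz p.K) (theta13LiveOfNumerics F 2 n ε₂₉ (zeta316OfRecord F 2 n.ν n.τ9.M n.A₁) (RzOfRecord F 2) (ZtOfRecord F 2)).τ9.M j (Sect2.domSites (F.P p.K) (theta13LiveOfNumerics F 2 n ε₂₉ (zeta316OfRecord F 2 n.ν n.τ9.M n.A₁) (RzOfRecord F 2)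 (ZtOfRecord F 2)).τ9.M j X)
            ((settingOfRecord₁₃ F 2 (theta13LiveOfNumerics F 2 n ε₂₉ (zeta316OfRecord F 2 n.ν n.τ9.M n.A₁) (RzOfRecord F 2) (ZtOfRecord F 2)) p).lf.alpha0 ((settingOfRecord₁₃ F 2 (theta13LiveOfNumerics F 2 n ε₂₉ (zeta316OfRecord F 2 n.ν n.τ9.M n.A₁) (RzOfRecord F 2) (ZtOfRecord F 2)) p).flow.g j)) ((settingOfRecord₁₃ F 2 (theta13LiveOfNumerics F 2 n ε₂₉ (zeta316OfRecord F 2 n.ν n.τ9.M n.A₁) (RzOfRecord F 2) (ZtOfRecord F 2)) p).lf.alpha1 ((settingOfRecord₁₃ F 2 (theta13LiveOfNumerics F 2 n ε₂₉ (zeta316OfRecord F 2 n.ν n.τ9.M n.A₁) (RzOfRecord F 2) (ZtOfRecord F 2)) p).flow.g j))) ∧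
      (Sect2.admB (F.P p.K) (theta13LiveOfNumerics F 2 n ε₂₉ (zeta316OfRecord F 2 n.ν n.τ9.M n.A₁) (RzOfRecord F 2) (ZtOfRecord F 2)).ν (theta13LiveOfNumerics F 2 n ε₂₉ (zeta316OfRecord F 2 n.ν n.τ9.M n.A₁) (RzOfRecord F 2) (ZtOfRecord F 2)).τ9.M (gOfRecord₁₃ F 2 (theta13LiveOfNumerics F 2 n ε₂₉ (zeta316OfRecord F 2 n.ν n.τ9.M n.A₁) (RzOfRecord F 2) (ZtOfRecord F 2)) p) s.Ω s.Λ j (Sect2.domSites (F.P p.K) (theta13LiveOfNumerics F 2 n ε₂₉ (zeta316OfRecord F 2 n.ν n.τ9.M n.A₁) (RzOfRecord F 2) (ZtOfRecord F 2)).τ9.M j X) = true →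
        Sect2.ofBackgroundC (settingOfRecord₁₃ F 2 (theta13LiveOfNumerics F 2 n ε₂₉ (zeta316OfRecord F 2 n.ν n.τ9.M n.A₁) (RzOfRecord F 2) (ZtOfRecord F 2)) p).ι (UbgOfRecord₁₃ F 2 (theta13LiveOfNumerics F 2 n ε₂₉ (zeta316OfRecord F 2 n.ν n.τ9.M n.A₁) (RzOfRecord F 2) (ZtOfRecord F 2)) p m s W) ∈
          Sect2.spaceMS (settingOfRecord₁₃ F 2 (theta13LiveOfNumerics F 2 n ε₂₉ (zeta316OfRecord F 2 n.ν n.τ9.M n.A₁) (RzOfRecord F 2) (ZtOfRecord F 2)) p) ((theta13LiveOfNumerics F 2 n ε₂₉ (zeta316OfRecord F 2 n.ν n.τ9.M n.A₁) (RzOfRecord F 2) (ZtOfRecord F 2)).Rz p.K) (theta13LiveOfNumerics F 2 n ε₂₉ (zeta316OfRecord F 2 n.ν n.τ9.M n.A₁) (RzOfRecord F 2) (ZtOfRecord F 2)).τ9.M j (Sect2.domSites (F.P p.K) (theta13LiveOfNumerics F 2 n ε₂₉ (zeta316OfRecord F 2 n.ν n.τ9.M n.A₁) (RzOfRecord F 2)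 (ZtOfRecord F 2)).τ9.M j X) s.Ω)) :
    ∃ θ : Stage13Params F 2, θ.Provisos₁₃Sep F 2 ∧ (θ.ZtUnity F 2 ∧ θ.SlotsNondegenerate₁₃ F 2) ∧ θ.Admissible F 2 :=
  ⟨_, provisos₁₃Sep_theta13LiveOfNumerics_of_bgSep F 2 n ε₂₉ hbgSep,
    ⟨ztUnity_theta13LiveOfNumerics F 2 n ε₂₉, slotsNondegenerate₁₃_theta13LiveOfNumerics_of_hasResiduals F 2 n ε₂₉⟩,
    admissible_theta13LiveOfNumerics F 2 _ _ _ hn hε'⟩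

/-- **THE PRINT-STRONGER K0‴ BODY GIVES THE ⁗ ONE** (def-T's one-way map `Provisos₁₃.toSep`; the converse is NOT claimed — the guarded row says nothing over
non-separated sequences or incompatible runs). [cite: Balaban1988Convergent, (2.28) p.259; Balaban1985RegularSpaces, (1.3)–(1.6) p.77 (bookkeeping)] -/
theorem exists_k0Sep_of_exists_k0 (F : T4Family)
    (h : ∃ θ : Stage13Params F 2, θ.Provisos₁₃ F 2 ∧ (θ.ZtUnity F 2 ∧ θ.SlotsNondegenerate₁₃ F 2) ∧ θ.Admissible F 2) :
    ∃ θ : Stage13Params F 2, θ.Provisos₁₃Sep F 2 ∧ (θ.ZtUnity F 2 ∧ θ.SlotsNondegenerate₁₃ F 2) ∧ θ.Admissible F 2 :=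
  h.imp fun _ hθ => ⟨hθ.1.toSep, hθ.2⟩

end AllNumericsSep

end Literature.MathematicalPhysics.QuantumFieldTheory.Balaban1983to89.Node00

end
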